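import Literature.Computability.Cryptography.FGComplexity
import Literature.Computability.Cryptography.WordRAMProofs
import Literature.Computability.Cryptography.WordRAMUniversal2
import Mathlib.Algebra.Order.BigOperators.Group.List
import HarnessLib

/-!
# Fine-grained complexity on the word RAM — refutation of the uncorrected transfer property

The transfer property of fine-grained reductions *as first transcribed* in
`Literature.Computability.Cryptography.FGComplexity` (V. Vassilevska Williams, ICM 2018, the
remark following Def. 2.1, vendored *without* the lower-bound half of the `Θ(log n)`-bit-word
convention, i.e. with nothing tying the size measure `n = A.size x` to the input length; until
2026-08-14 the named facts `FGReducible.trulySubTime` and `FGReducible.trulySubTime'` of that file,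
since retired from the fact ledger) is **false** in the word-RAM model of
`Literature.Computability.Cryptography.WordRAM`: `FGReducible.trulySubTime'_false`,
`FGReducible.trulySubTime_false`. Both theorems state the refuted proposition *verbatim, inlined*
(the uncorrected transcription is recorded nowhere else in the tree, and this file does not depend
on the retired names). The corrected statement `FGReducible.trulySubTime_of_sizeFitsWord` (extra
hypothesis `FGProblem.SizeFitsWord`) is proved in
`Literature.Computability.Cryptography.FGComplexityProofs`. So are the two uncorrected equivalence
versions (until 2026-08-14 the named facts `SubcubicEquivalent.trulySubTime_iff` — Vassilevska
Williams–Williams, J. ACM 2018, §3, Prop. 2 with Def. 3.1, transcribed for arbitrary size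
measures — and `SubquadraticEquivalent.trulySubTime_iff`), again inlined:
`SubcubicEquivalent.trulySubTime_iff_false`, `SubquadraticEquivalent.trulySubTime_iff_false` (last
section; corrected statements `SubcubicEquivalent.trulySubTime_iff_of_sizeFitsWord`,
`SubquadraticEquivalent.trulySubTime_iff_of_sizeFitsWord`, proved as `…_holds` in
`Literature.Computability.Cryptography.FGComplexityProofs`).

This file is the kernel-checked refutation. It supersedes the informal refutation sketch (a
space-hard problem of doubly exponential size driven through a two-counter machine; space
hierarchy) recorded in the section *Size measures that fit in a word* of
`Literature.Computability.Cryptography.FGComplexity`: the construction that is actually formalised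
is the diagonal / universal-program one below, and the pointers there should be read as pointing
to `FGReducible.trulySubTime_false` (and, for the two equivalence versions, to
`SubcubicEquivalent.trulySubTime_iff_false` / `SubquadraticEquivalent.trulySubTime_iff_false`).
All auxiliary definitions
(`univA`, `univB`, `orbitM`, `cost`, `rounds`, `univAPow`, `costPow`, …) live in the sub-namespace
`Literature.Computability.Cryptography.TrulySubTimeRefutation`; only the refutation theorems, the
packaged counterexamples `exists_…_not_trulySubTime` and the generic
`FGProblem.TrulySubTime.fgReducible_of_pos` are declared at the level of the facts they refute.

The counterexample (all sizes are free in `FGProblem`, so only the exactness of the model is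
exploited — `WordRAM.step` stores the *length* of an oracle answer unreduced):

* `univB`, the oracle problem: instances are all word lists `q`, `size q = max |q| (max q)`,
  the unique good answer is `Univ.uAnswer q` of `WordRAMUniversal2` — `[]` on ill-formed `q`,
  the *grow* answer `q ++ 0^(2|q|)` while `q` is below the state-count threshold of the program
  stored in its header, and `[1 + bit]` above it, `bit` telling whether the stored program,
  run at the stored word-size constant on the header, halts with output `[1]`. The universal
  program `Univ.U` solves it in linear time (`univB_trulySubTime`: truly sub-`n²`), and it is well
  formed for the budget `n ^ 2` (`univB_isStandard`).
* `univA`, the diagonal problem: instances are pairs `(P, k)` of a deterministic oracle-free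
  program and a word-size constant, encoded as the header `[0, |P|, k] ++ code P`; the good
  answer is `[2]` if `P`, run at word size `k · width` on this very encoding, ever outputs `[1]`,
  and `[1]` otherwise; `size` is the square of the cost of the reduction below. No word-RAM
  algorithm solves `univA` in any time bound (`not_inTimeInst_univA`, the diagonal argument with
  `WordRAM.outputsWithin_unique_holds`), in particular `univA` is not truly sub-`n¹`; it is well
  formed for the budget `n ^ 1` (`univA_isStandard`).
* `(univA, n) ≤_FG (univB, n²)` (`fgReducible_univA_univB`) by the three-instruction program
  `orbitM = [query (imm 1) (dir 0) (imm 0); jz (dir 1) 0; halt]`: each query is the previous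
  answer read back verbatim, so the oracle drives the orbit `q₀ = encode x`,
  `qᵢ₊₁ = qᵢ ++ 0^(2|qᵢ|)` until the threshold is passed, where the answer bit decides the
  *unbounded* halting question by eventual periodicity (`WordRAM.OutputsWithin.stateBound` of
  `WordRAMPigeonhole`); the budgets hold because `size` was chosen as the square of the cost.
* Equivalence versions (last section): for a common budget `n ^ p` on both sides (`p = 3`:
  `SubcubicEquivalent`, `p = 2`: `SubquadraticEquivalent`) the diagonal problem is given the size
  measure `costPow p` (the cost with the `p`-th powers of the query masses, so that the ledger
  `∑ (mᵢ^p)^{1-ε} ≤ ∑ mᵢ^p` is affordable at `δ = 1 - 1/p`): `univAPow p`. Then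
  `(univAPow p, n^p) ≤_FG (univB, n^p)` by the same orbit reduction
  (`fgReducible_univAPow_univB`), `(univB, n^p) ≤_FG (univAPow p, n^p)` trivially, since a truly
  sub-`n^α` problem (`α > 0`) reduces to anything by running its oracle-free algorithm without
  queries (`FGProblem.TrulySubTime.fgReducible_of_pos`), both problems are well formed for `n ^ p`
  (`univAPow_isStandard`, `univB_isStandard_pow`), `univB` is truly sub-`n^p` and `univAPow p` has
  no algorithm (`not_inTimeInst_univAPow`): `exists_fgEquivalent_pow_not_trulySubTime`,
  specialised to `exists_subcubicEquivalent_not_trulySubTime`,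
  `exists_subquadraticEquivalent_not_trulySubTime`.

## References

* V. Vassilevska Williams, *On some fine-grained questions in algorithms and complexity*,
  Proc. ICM 2018, §2, Def. 2.1 and the remark following it.
* V. Vassilevska Williams, R. Williams, *Subcubic equivalences between path, matrix, and triangle
  problems*, J. ACM 65 (2018), art. 27, §3, Def. 3.1 (subcubic reductions, `A ≡₃ B`) and Prop. 2
  (p. 27:11: "If `A ≤₃ B`, then a truly subcubic algorithm for `B` implies a truly subcubic
  algorithm for `A`", for problems on `n × n` matrices).
* S. A. Cook, R. A. Reckhow, *Time bounded random access machines*, JCSS 7 (1973), §§2–4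
  (stored RAM programs interpreted by a universal program; diagonalisation over RAM programs).
-/

namespace Literature.Computability.Cryptography

open WordRAM WordRAM.Univ

namespace TrulySubTimeRefutation

/-! ## The oracle problem -/

/-- The size measure of the oracle problem: `max |q| (max q)`. [folklore] -/
def massOf (q : List ℕ) : ℕ := max q.length (lmax q)

/-- **The oracle problem** `univB`: all word lists, answered by `Univ.uAnswer` (reducible, so
that its instances are seen as word lists). [folklore] -/
@[reducible] def univB : FGProblem where
  Inst := List ℕ
  encode := fun q => q
  size := massOf
  Good := fun q => {uAnswer q}

/-- The input width is at most the mass plus one. [folklore] -/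
theorem inputWidth_le_massOf (q : List ℕ) : inputWidth q ≤ massOf q + 1 := by
  unfold inputWidth massOf
  refine le_trans (Nat.size_le.2 Nat.lt_two_pow_self) ?_
  rw [foldr_max_eq]
  omega

/-- The answer bit is `0` or `1`. [folklore] -/
theorem bitOf_le_one (q : List ℕ) : bitOf q ≤ 1 := by
  unfold bitOf; split_ifs <;> omega

/-- The answers of the oracle problem are word-representable (`k = 2`, `C = 3`). [folklore] -/
theorem univB_hasWordOutputs : univB.HasWordOutputs := by
  refine ⟨2, 3, fun (q : List ℕ) out hout => ?_⟩
  simp only [Set.mem_singleton_iff] at hout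
  subst hout
  have hw : 4 ≤ 2 ^ (2 * inputWidth q) := by
    have := Nat.pow_le_pow_right (show 0 < 2 by norm_num) (show 2 ≤ 2 * inputWidth q by
      have := inputWidth_pos q; omega)
    simpa using this
  have hq : ∀ v ∈ q, v < 2 ^ (2 * inputWidth q) := fun v hv =>
    lt_of_lt_of_le (lt_two_pow_inputWidth_of_mem q v hv) (Nat.pow_le_pow_right (by norm_num) (by omega))
  show (uAnswer q).length ≤ 3 * q.length + 3 ∧ ∀ v ∈ uAnswer q, v < 2 ^ (2 * inputWidth q)
  unfold uAnswer
  split_ifs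
  · refine ⟨by simp, fun v hv => ?_⟩
    simp only [List.mem_singleton] at hv
    have := bitOf_le_one q; omega
  · refine ⟨by simp; omega, fun v hv => ?_⟩
    rcases List.mem_append.1 hv with h | h
    · exact hq v h
    · rw [List.eq_of_mem_replicate h]; omega
  · exact ⟨by simp, fun v hv => by simp at hv⟩

/-- `((m : ℝ) ^ 2) ^ (1/2) = m`. [folklore] -/
theorem rpow_two_rpow_half (m : ℕ) : ((m : ℝ) ^ (2 : ℝ)) ^ (1 - 1 / 2 : ℝ) = m := by
  rw [show (1 - 1 / 2 : ℝ) = 1 / 2 by norm_num, Real.rpow_two, ← Real.sqrt_eq_rpow,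
    Real.sqrt_sq (Nat.cast_nonneg _)]

/-- **The oracle problem is well formed for the budget `n ^ 2`.** [folklore] -/
theorem univB_isStandard : univB.IsStandard fun n => (n : ℝ) ^ (2 : ℝ) where
  nonneg := fun n => Real.rpow_nonneg (Nat.cast_nonneg _) _
  length_le := ⟨1, 1 / 2, by norm_num, fun q => by
    show ((q.length : ℕ) : ℝ) ≤ 1 * ((massOf q : ℝ) ^ (2 : ℝ)) ^ (1 - 1 / 2 : ℝ) + 1
    rw [rpow_two_rpow_half, one_mul]
    have : q.length ≤ massOf q := le_max_left _ _
    have : (q.length : ℝ) ≤ massOf q := by exact_mod_cast this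
    linarith⟩
  width_le := ⟨1, fun q => by
    show ((inputWidth q : ℕ) : ℝ) ≤ 1 * (massOf q : ℝ) ^ (2 : ℝ) + 1
    rw [Real.rpow_two, one_mul]
    have h1 := inputWidth_le_massOf q
    have h2 : massOf q ≤ massOf q ^ 2 := by
      rcases Nat.eq_zero_or_pos (massOf q) with h | h
      · rw [h]; simp
      · calc massOf q = massOf q * 1 := (Nat.mul_one _).symm
          _ ≤ massOf q * massOf q := Nat.mul_le_mul_left _ h
          _ = massOf q ^ 2 := (sq _).symm
    have : (inputWidth q : ℝ) ≤ (massOf q : ℝ) ^ 2 + 1 := by exact_mod_cast (by omega : inputWidth q ≤ massOf q ^ 2 + 1)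
    linarith⟩
  hasWordOutputs := univB_hasWordOutputs

/-- The cost of the universal program is linear in the mass. [folklore] -/
theorem uCost_le_massOf (q : List ℕ) : uCost q.length (10 * inputWidth q) ≤ 1100 * massOf q + 1100 := by
  have h1 : Nat.size (10 * inputWidth q) ≤ 10 * inputWidth q := Nat.size_le.2 Nat.lt_two_pow_self
  have h2 := inputWidth_le_massOf q
  have h3 : q.length ≤ massOf q := le_max_left _ _
  unfold uCost Inline.proCost widthCost
  omega

/-- **The oracle problem is truly sub-`n²`**: the universal program solves it in time `O(n)`. [folklore] -/
theorem univB_trulySubTime : univB.TrulySubTime 2 := by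
  refine ⟨1, one_pos, 1100, U, 10, U_isDeterministic, U_isOracleFree, fun q => ⟨uAnswer q, rfl, ?_⟩⟩
  refine (outputsWithin_U q).mono ?_
  refine le_trans (uCost_le_massOf q) (Nat.le_floor ?_)
  show ((1100 * massOf q + 1100 : ℕ) : ℝ) ≤ 1100 * ((massOf q : ℕ) : ℝ) ^ ((2 : ℝ) - 1) + 1100
  rw [show (2 : ℝ) - 1 = 1 by norm_num, Real.rpow_one]
  push_cast
  exact le_rfl

/-! ## The diagonal problem -/

/-- Instances of the diagonal problem: a deterministic oracle-free program and a word-size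
constant. [folklore] -/
structure DiagInst where
  /-- The program. -/
  prog : Program
  /-- The word-size constant. -/
  k : ℕ
  /-- The program is deterministic. -/
  det : prog.IsDeterministic
  /-- The program is oracle-free. -/
  ofree : prog.IsOracleFree

/-- The encoding of an instance: the header `[0, |P|, k] ++ code P` interpreted by `Univ.U`. [folklore] -/
def diagEncode (x : DiagInst) : List ℕ := [0, x.prog.length, x.k] ++ Program.code x.prog

/-- `x` is *self-accepting*: its program, run at word size `k · width` on its own encoding, outputs
`[1]` at some time. [folklore] -/
def SelfAccepts (x : DiagInst) : Prop :=
  ∃ t, OutputsWithin x.prog (x.k * inputWidth (diagEncode x)) noOracle zeroCoins (diagEncode x) [1] t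

open Classical in
/-- The good answer of the diagonal problem: `[2]` on self-accepting instances, `[1]` otherwise. [folklore] -/
noncomputable def diagGood (x : DiagInst) : Set (List ℕ) := if SelfAccepts x then {[2]} else {[1]}

/-! ### The orbit of the reduction -/

/-- The orbit of queries: `q₀ = encode x`, `qᵢ₊₁ = qᵢ ++ 0^(2|qᵢ|)`. [folklore] -/
def orb (x : DiagInst) : ℕ → List ℕ
  | 0 => diagEncode x
  | i + 1 => orb x i ++ List.replicate (2 * (orb x i).length) 0

/-- Orbit elements are the encoding followed by zeros. [folklore] -/
theorem orb_eq (x : DiagInst) (i : ℕ) : ∃ z, orb x i = diagEncode x ++ List.replicate z 0 := by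
  induction i with
  | zero => exact ⟨0, by simp [orb]⟩
  | succ i ih =>
    obtain ⟨z, hz⟩ := ih
    exact ⟨z + 2 * (orb x i).length, by rw [orb, hz, List.append_assoc, ← List.replicate_add]⟩

/-- The length of the encoding. [folklore] -/
@[simp] theorem diagEncode_length (x : DiagInst) : (diagEncode x).length = 3 + 8 * x.prog.length := by
  simp [diagEncode]; omega

/-- The lengths of the orbit triple. [folklore] -/
theorem orb_length (x : DiagInst) (i : ℕ) : (orb x i).length = (3 + 8 * x.prog.length) * 3 ^ i := by
  induction i with
  | zero => simp [orb]
  | succ i ih => rw [orb, List.length_append, List.length_replicate, ih, pow_succ]; ring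

/-- Word `0` of an orbit element is `0`. [folklore] -/
theorem orb_getD_zero (x : DiagInst) (i : ℕ) : (orb x i).getD 0 0 = 0 := by
  obtain ⟨z, hz⟩ := orb_eq x i; rw [hz]; simp [diagEncode]

/-- Word `1` of an orbit element is `|P|`. [folklore] -/
theorem nPOf_orb (x : DiagInst) (i : ℕ) : nPOf (orb x i) = x.prog.length := by
  obtain ⟨z, hz⟩ := orb_eq x i; rw [nPOf, hz]; simp [diagEncode]

/-- Word `2` of an orbit element is `k`. [folklore] -/
theorem kOf_orb (x : DiagInst) (i : ℕ) : kOf (orb x i) = x.k := by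
  obtain ⟨z, hz⟩ := orb_eq x i; rw [kOf, hz]; simp [diagEncode]

/-- The announced header length of an orbit element is the length of the encoding. [folklore] -/
theorem lhOf_orb (x : DiagInst) (i : ℕ) : lhOf (orb x i) = (diagEncode x).length := by
  rw [lhOf, nPOf_orb, diagEncode_length]

/-- The header of an orbit element is the encoding. [folklore] -/
theorem hdrOf_orb (x : DiagInst) (i : ℕ) : hdrOf (orb x i) = diagEncode x := by
  obtain ⟨z, hz⟩ := orb_eq x i
  rw [hdrOf, lhOf_orb, hz, List.take_append_of_le_length le_rfl, List.take_length]

/-- Orbit elements are well formed. [folklore] -/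
theorem wf_orb (x : DiagInst) (i : ℕ) : WF (orb x i) := by
  refine ⟨orb_getD_zero x i, ?_⟩
  obtain ⟨z, hz⟩ := orb_eq x i
  rw [lhOf_orb, hz, List.length_append]; omega

/-- The stored program of an orbit element is `P`. [folklore] -/
theorem progOf_orb (x : DiagInst) (i : ℕ) : progOf (orb x i) = x.prog := by
  obtain ⟨z, hz⟩ := orb_eq x i
  rw [progOf, nPOf_orb, hz, diagEncode, List.append_assoc, List.drop_append_of_le_length (by simp)]
  simpa using Program.decode_code x.det x.ofree (List.replicate z 0)

/-- The simulated word size of an orbit element is `k · width`. [folklore] -/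
theorem w0Of_orb (x : DiagInst) (i : ℕ) : w0Of (orb x i) = x.k * inputWidth (diagEncode x) := by
  rw [w0Of, kOf_orb, hdrOf_orb]

/-- The threshold quantity `2 ^ e` is constant along the orbit. [folklore] -/
theorem tOf_orb (x : DiagInst) (i : ℕ) : tOf (orb x i) = tOf (orb x 0) := by
  simp only [tOf, eOf, kOf_orb, hdrOf_orb]

/-- Entries of orbit elements are entries of the encoding or `0`. [folklore] -/
theorem lt_of_mem_orb (x : DiagInst) (i : ℕ) {v : ℕ} (hv : v ∈ orb x i) : v < 2 ^ inputWidth (diagEncode x) := by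
  obtain ⟨z, hz⟩ := orb_eq x i
  rw [hz] at hv
  rcases List.mem_append.1 hv with h | h
  · exact lt_two_pow_inputWidth_of_mem _ _ h
  · rw [List.eq_of_mem_replicate h]; exact Nat.two_pow_pos _

/-- Some orbit element is big. [folklore] -/
theorem exists_big_orb (x : DiagInst) : ∃ i, Big (orb x i) := by
  set T := max (tOf (orb x 0)) ((x.prog.length + 1) * tOf (orb x 0) ^ tOf (orb x 0)) with hT
  refine ⟨T, ?_⟩
  have hlen : T ≤ (orb x T).length := by
    rw [orb_length]
    have h3 : T < 3 ^ T := Nat.lt_pow_self (by norm_num)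
    have : 3 ^ T ≤ (3 + 8 * x.prog.length) * 3 ^ T := Nat.le_mul_of_pos_left _ (by omega)
    omega
  refine ⟨?_, ?_⟩
  · rw [tOf_orb]; exact le_trans (le_max_left _ _) hlen
  · rw [tOf_orb, nPOf_orb]; exact le_trans (le_max_right _ _) hlen

open Classical in
/-- The number of grow rounds: the first big orbit element. [folklore] -/
noncomputable def rounds (x : DiagInst) : ℕ := Nat.find (exists_big_orb x)

/-- The orbit element at `rounds x` is big. [folklore] -/
theorem big_orb_rounds (x : DiagInst) : Big (orb x (rounds x)) := by
  classical exact Nat.find_spec (exists_big_orb x)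

/-- Earlier orbit elements are not big. [folklore] -/
theorem not_big_orb {x : DiagInst} {i : ℕ} (hi : i < rounds x) : ¬ Big (orb x i) := by
  classical exact Nat.find_min (exists_big_orb x) hi

/-- The oracle's answer on a non-final orbit element is the next one. [folklore] -/
theorem uAnswer_orb_of_lt {x : DiagInst} {i : ℕ} (hi : i < rounds x) : uAnswer (orb x i) = orb x (i + 1) := by
  rw [uAnswer, if_pos (wf_orb x i), if_neg (not_big_orb hi), orb]

/-- The oracle's answer on the final orbit element is `[1 + bit]`. [folklore] -/
theorem uAnswer_orb_rounds (x : DiagInst) : uAnswer (orb x (rounds x)) = [1 + bitOf (orb x (rounds x))] := by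
  rw [uAnswer, if_pos (wf_orb x _), if_pos (big_orb_rounds x)]

open Classical in
/-- **The answer bit decides self-acceptance** (eventual periodicity: the fuel `|q|` of the final
orbit element exceeds the state bound of `P` at word size `k · width`). [folklore] -/
theorem bitOf_orb_rounds (x : DiagInst) : bitOf (orb x (rounds x)) = if SelfAccepts x then 1 else 0 := by
  set q := orb x (rounds x) with hq
  have hbig := big_orb_rounds x
  have hWF := wf_orb x (rounds x)
  have hP := progOf_orb x (rounds x)
  have hw := w0Of_orb x (rounds x)
  have hh := hdrOf_orb x (rounds x)
  -- the state bound fits in the fuel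
  have hsb : stateBound x.prog (x.k * inputWidth (diagEncode x)) ≤ q.length := by
    have hV := valueBound_progOf_le hWF
    rw [hP, hw] at hV
    refine le_trans (stateBound_le hV) ?_
    have ht : 1 ≤ tOf q := by have := two_le_tOf q; omega
    have h1 : 1 ≤ tOf q ^ tOf q := Nat.one_le_pow _ _ ht
    have h2 := hbig.2
    rw [nPOf_orb] at h2
    rw [Nat.sub_add_cancel ht]
    calc x.prog.length * tOf q ^ tOf q + 1 ≤ x.prog.length * tOf q ^ tOf q + tOf q ^ tOf q := by omega
      _ = (x.prog.length + 1) * tOf q ^ tOf q := by ring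
      _ ≤ q.length := h2
  have hiff : ((cfgOf q).pc = none ∧ readOut (cfgOf q).mem = [1]) ↔ SelfAccepts x := by
    rw [cfgOf, hP, hw, hh, ← outputsWithin_iff_runTotal]
    constructor
    · exact fun h => ⟨_, h⟩
    · rintro ⟨t, ht⟩
      exact ht.stateBound x.det x.ofree hsb
  unfold bitOf
  by_cases h : SelfAccepts x
  · rw [if_pos (hiff.2 h), if_pos h]
  · rw [if_neg (fun h' => h (hiff.1 h')), if_neg h]

/-! ### The cost and the diagonal problem -/

/-- The cost of the reduction on `x`: its running time plus, for every query, its length and the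
square of its mass. [folklore] -/
noncomputable def cost (x : DiagInst) : ℕ :=
  2 * rounds x + 3 + ((List.range (rounds x + 1)).map fun i => (orb x i).length + massOf (orb x i) ^ 2).sum

/-- **The diagonal problem** `univA` (size = cost squared; reducible). [folklore] -/
@[reducible] noncomputable def univA : FGProblem where
  Inst := DiagInst
  encode := diagEncode
  size := fun x => cost x ^ 2
  Good := diagGood

/-- Each query's length and squared mass is within the cost. [folklore] -/
theorem term_le_cost (x : DiagInst) {i : ℕ} (hi : i ≤ rounds x) :
    (orb x i).length + massOf (orb x i) ^ 2 ≤ cost x := by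
  unfold cost
  have : (orb x i).length + massOf (orb x i) ^ 2 ≤
      ((List.range (rounds x + 1)).map fun i => (orb x i).length + massOf (orb x i) ^ 2).sum :=
    List.single_le_sum (fun _ _ => Nat.zero_le _) _
      (List.mem_map.2 ⟨i, List.mem_range.2 (by omega), rfl⟩)
  omega

/-- The encoding length is within the cost. [folklore] -/
theorem length_le_cost (x : DiagInst) : (diagEncode x).length ≤ cost x := by
  have := term_le_cost x (Nat.zero_le _)
  simp only [orb] at this
  omega

/-- **No word-RAM algorithm solves the diagonal problem**, in any time bound: run the candidate on
its own code. [folklore] -/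
theorem not_inTimeInst_univA (T : univA.Inst → ℕ) : ¬ univA.InTimeInst T := by
  rintro ⟨M, k, hd, ho, hM⟩
  let x₀ : DiagInst := ⟨M, k, hd, ho⟩
  obtain ⟨out, hout, hrun⟩ := hM x₀
  change out ∈ diagGood x₀ at hout
  change OutputsWithin M (k * inputWidth (diagEncode x₀)) noOracle zeroCoins (diagEncode x₀) out (T x₀) at hrun
  unfold diagGood at hout
  by_cases h : SelfAccepts x₀
  · rw [if_pos h, Set.mem_singleton_iff] at hout
    subst hout
    obtain ⟨t, ht⟩ := h
    have := outputsWithin_unique_holds hrun ht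
    simp at this
  · rw [if_neg h, Set.mem_singleton_iff] at hout
    subst hout
    exact h ⟨_, hrun⟩

/-- The diagonal problem is not truly sub-`n^α`, for any `α`. [folklore] -/
theorem not_trulySubTime_univA (α : ℝ) : ¬ univA.TrulySubTime α := by
  rintro ⟨ε, -, C, h⟩
  exact not_inTimeInst_univA _ h

/-- The answers of the diagonal problem are `[1]` or `[2]`. [folklore] -/
theorem univA_hasWordOutputs : univA.HasWordOutputs := by
  refine ⟨2, 1, fun x out hout => ?_⟩
  change out ∈ diagGood x at hout
  have hw : 4 ≤ 2 ^ (2 * univA.width x) := by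
    have := Nat.pow_le_pow_right (show 0 < 2 by norm_num) (show 2 ≤ 2 * univA.width x by
      have := univA.width_pos x; omega)
    simpa using this
  unfold diagGood at hout
  split_ifs at hout <;>
  · rw [Set.mem_singleton_iff] at hout; subst hout
    exact ⟨by simp, fun v hv => by simp at hv; omega⟩

/-- `((c ^ 2 : ℕ) ^ 1) ^ (1/2) = c` for the budget `n ^ 1` at `δ = 1/2`. [folklore] -/
theorem budget_eq (c : ℕ) : (((c ^ 2 : ℕ) : ℝ) ^ (1 : ℝ)) ^ (1 - 1 / 2 : ℝ) = c := by
  rw [Real.rpow_one, Nat.cast_pow, ← Real.rpow_two, rpow_two_rpow_half]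

/-- **The diagonal problem is well formed for the budget `n ^ 1`.** [folklore] -/
theorem univA_isStandard : univA.IsStandard fun n => (n : ℝ) ^ (1 : ℝ) where
  nonneg := fun n => Real.rpow_nonneg (Nat.cast_nonneg _) _
  length_le := ⟨1, 1 / 2, by norm_num, fun x => by
    show ((diagEncode x).length : ℝ) ≤ 1 * (((cost x ^ 2 : ℕ) : ℝ) ^ (1 : ℝ)) ^ (1 - 1 / 2 : ℝ) + 1
    rw [budget_eq, one_mul]
    have : ((diagEncode x).length : ℝ) ≤ cost x := by exact_mod_cast length_le_cost x
    linarith⟩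
  width_le := ⟨1, fun x => by
    show ((inputWidth (diagEncode x) : ℕ) : ℝ) ≤ 1 * ((cost x ^ 2 : ℕ) : ℝ) ^ (1 : ℝ) + 1
    rw [Real.rpow_one, one_mul]
    have h1 := inputWidth_le_massOf (diagEncode x)
    have h2 : massOf (diagEncode x) ^ 2 ≤ cost x := by
      have := term_le_cost x (Nat.zero_le _); simp only [orb] at this; omega
    have h3 : massOf (diagEncode x) ≤ massOf (diagEncode x) ^ 2 := by
      rcases Nat.eq_zero_or_pos (massOf (diagEncode x)) with h | h
      · rw [h]; simp
      · calc massOf (diagEncode x) = massOf (diagEncode x) * 1 := (Nat.mul_one _).symm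
          _ ≤ massOf (diagEncode x) * massOf (diagEncode x) := Nat.mul_le_mul_left _ h
          _ = _ := (sq _).symm
    have h4 : cost x ≤ cost x ^ 2 := by
      rcases Nat.eq_zero_or_pos (cost x) with h | h
      · rw [h]; simp
      · calc cost x = cost x * 1 := (Nat.mul_one _).symm
          _ ≤ cost x * cost x := Nat.mul_le_mul_left _ h
          _ = _ := (sq _).symm
    have : (inputWidth (diagEncode x) : ℝ) ≤ ((cost x ^ 2 : ℕ) : ℝ) + 1 := by
      exact_mod_cast (by omega : inputWidth (diagEncode x) ≤ cost x ^ 2 + 1)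
    linarith⟩
  hasWordOutputs := univA_hasWordOutputs

/-! ### The reduction -/

/-- The reduction: re-query the previous answer until it is final. [folklore] -/
def orbitM : Program := [.query (.imm 1) (.dir 0) (.imm 0), .jz (.dir 1) 0, .halt]

/-- The reduction is deterministic. [folklore] -/
theorem orbitM_isDeterministic : orbitM.IsDeterministic := by decide

/-- The memory holding `q` in output position: cell `0 = |q|`, cells `1 … = q`, then zeros. [folklore] -/
def memOf (q : List ℕ) : ℕ → ℕ := fun a => if a = 0 then q.length else q.getD (a - 1) 0

/-- The initial memory on `q` is `memOf q` when the word size holds the input. [folklore] -/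
theorem init_mem_eq_memOf {w : ℕ} {q : List ℕ} (h : inputWidth q ≤ w) : (init w q).mem = memOf q := by
  funext a
  unfold memOf
  rcases Nat.eq_zero_or_pos a with rfl | ha
  · rw [if_pos rfl, init_mem_zero_of_inputWidth_le h]
  · rw [if_neg (by omega)]
    obtain ⟨j, rfl⟩ : ∃ j, a = j + 1 := ⟨a - 1, by omega⟩
    rw [Nat.add_sub_cancel, List.getD_eq_getElem?_getD]
    by_cases hj : j < q.length
    · rw [Inline.init_mem_succ_exact h hj, List.getElem?_eq_getElem hj]; rfl
    · rw [init_mem_of_length_lt _ _ _ (by omega), List.getElem?_eq_none (by omega)]; rfl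

/-- The output segment of `memOf q` is `q`. [folklore] -/
theorem readSeg_memOf (q : List ℕ) : readSeg (memOf q) 1 q.length = q := by
  apply List.ext_getElem (by simp)
  intro j h1 h2
  simp only [readSeg, List.getElem_map, List.getElem_range, memOf]
  rw [if_neg (by omega), show 1 + j - 1 = j by omega, List.getD_eq_getElem?_getD,
    List.getElem?_eq_getElem h2]
  rfl

/-- Overwriting the output segment with a longer list. [folklore] -/
theorem writeSeg_memOf {q q' : List ℕ} (h : q.length ≤ q'.length) :
    writeSeg (Function.update (memOf q) 0 q'.length) 1 q' = memOf q' := by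
  funext a
  rw [writeSeg_apply]
  by_cases ha0 : a = 0
  · subst ha0
    rw [dif_neg (by omega), Function.update_self]
    simp [memOf]
  · by_cases hc : 1 ≤ a ∧ a < 1 + q'.length
    · rw [dif_pos hc]
      simp only [memOf, if_neg ha0]
      rw [List.getD_eq_getElem?_getD, List.getElem?_eq_getElem (by omega)]; rfl
    · rw [dif_neg hc, Function.update_of_ne ha0]
      simp only [memOf, if_neg ha0]
      rw [List.getD_eq_getElem?_getD, List.getD_eq_getElem?_getD, List.getElem?_eq_none (by omega),
        List.getElem?_eq_none (by omega)]

/-- **One grow round of the reduction**: query the output segment `q`, receive the longer answer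
`q'` (a list of words starting with `0`), and jump back. [folklore] -/
theorem orbitM_round {w : ℕ} {O : List ℕ → List ℕ} {q q' : List ℕ} (hO : O q = q')
    (hlen : q.length ≤ q'.length) (hw : ∀ v ∈ q', v < 2 ^ w) (h0 : q'.getD 0 0 = 0) (cp : ℕ)
    (qs : List (List ℕ)) :
    run orbitM w O zeroCoins 2 ⟨some 0, memOf q, cp, qs⟩ = some ⟨some 0, memOf q', cp, qs ++ [q]⟩ := by
  have hq : readSeg (memOf q) 1 (memOf q 0) = q := by simp only [memOf, if_true]; exact readSeg_memOf q
  have hs : step orbitM w O zeroCoins ⟨some 0, memOf q, cp, qs⟩ = some ⟨some 1, memOf q', cp, qs ++ [q]⟩ := by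
    rw [step_query (i := 0) rfl (show orbitM[0]? = some (.query (.imm 1) (.dir 0) (.imm 0)) from rfl)]
    simp only [Operand.read_imm, Operand.read_dir, hq, hO, map_mod_two_pow_eq_self hw, Nat.zero_add]
    rw [writeSeg_memOf hlen]
  rw [show (2 : ℕ) = 1 + 1 from rfl, run_add, run_one, hs, Option.bind_some, run_one,
    step_jz_zero (i := 1) rfl (show orbitM[1]? = some (.jz (.dir 1) 0) from rfl)]
  simp only [Operand.read_dir, memOf, show (1 : ℕ) ≠ 0 from one_ne_zero, if_false, Nat.sub_self, h0]

/-- The memory after the final answer `[b]`. [folklore] -/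
def finMem (q : List ℕ) (b : ℕ) : ℕ → ℕ := writeSeg (Function.update (memOf q) 0 1) 1 [b]

/-- The output after the final answer is `[b]`. [folklore] -/
theorem readOut_finMem (q : List ℕ) (b : ℕ) : readOut (finMem q b) = [b] := by
  have := readOut_answer (memOf q) [b]
  simpa [finMem] using this

/-- **The final round of the reduction**: query, receive `[b]` with `b ≠ 0` a word, fall through,
halt. [folklore] -/
theorem orbitM_final {w : ℕ} {O : List ℕ → List ℕ} {q : List ℕ} {b : ℕ} (hO : O q = [b]) (hb : b < 2 ^ w)
    (hb0 : b ≠ 0) (cp : ℕ) (qs : List (List ℕ)) :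
    run orbitM w O zeroCoins 3 ⟨some 0, memOf q, cp, qs⟩ = some ⟨none, finMem q b, cp, qs ++ [q]⟩ := by
  have hq : readSeg (memOf q) 1 (memOf q 0) = q := by simp only [memOf, if_true]; exact readSeg_memOf q
  have hs : step orbitM w O zeroCoins ⟨some 0, memOf q, cp, qs⟩ = some ⟨some 1, finMem q b, cp, qs ++ [q]⟩ := by
    rw [step_query (i := 0) rfl (show orbitM[0]? = some (.query (.imm 1) (.dir 0) (.imm 0)) from rfl)]
    simp only [Operand.read_imm, Operand.read_dir, hq, hO, List.map_cons, List.map_nil, Nat.mod_eq_of_lt hb,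
      Nat.zero_add, List.length_singleton]
    rfl
  have h1 : finMem q b 1 = b := by
    simp [finMem, writeSeg, Function.update_self]
  rw [show (3 : ℕ) = 1 + (1 + 1) from rfl, run_add, run_one, hs, Option.bind_some, run_add, run_one,
    step_jz_ne (i := 1) rfl (show orbitM[1]? = some (.jz (.dir 1) 0) from rfl) (by simpa [h1] using hb0),
    Option.bind_some, run_one, step_halt (i := 2) rfl (show orbitM[2]? = some .halt from rfl)]

/-- **The run of the reduction** on `x` with an oracle answering `univB`: after `2 i` steps
(`i ≤ rounds x`) the output segment holds the `i`-th orbit element and the first `i` orbit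
elements have been queried. [folklore] -/
theorem orbitM_run (x : DiagInst) {O : List ℕ → List ℕ} (hO : univB.OracleAnswers O) {w : ℕ}
    (hw : inputWidth (diagEncode x) ≤ w) :
    ∀ i, i ≤ rounds x → run orbitM w O zeroCoins (2 * i) (init w (diagEncode x)) =
      some ⟨some 0, memOf (orb x i), 0, (List.range i).map (orb x)⟩
  | 0, _ => by
      rw [Nat.mul_zero, run_zero]
      congr 1
      cases h : init w (diagEncode x) with
      | mk pc mem cp qs =>
        have h1 := congrArg Cfg.pc h; have h2 := congrArg Cfg.mem h
        have h3 := congrArg Cfg.coinPos h; have h4 := congrArg Cfg.queries h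
        simp only [init_pc, init_coinPos, init_queries] at h1 h3 h4
        rw [init_mem_eq_memOf hw] at h2
        simp only at h2
        rw [← h1, ← h2, ← h3, ← h4]; rfl
  | i + 1, hi => by
      have hOq : O (orb x i) = orb x (i + 1) := by
        have := hO (orb x i); simp only [Set.mem_singleton_iff] at this
        rw [this, uAnswer_orb_of_lt (by omega)]
      rw [show 2 * (i + 1) = 2 * i + 2 by ring, run_add, orbitM_run x hO hw i (by omega), Option.bind_some,
        orbitM_round hOq (by simp [orb]) (fun v hv => lt_of_lt_of_le (lt_of_mem_orb x _ hv)
          (Nat.pow_le_pow_right (by norm_num) hw)) (orb_getD_zero x _)]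
      simp [List.range_succ]

/-- **`(univA, n) ≤_FG (univB, n²)`.** [folklore] -/
theorem fgReducible_univA_univB :
    FGReducible univA (fun n => (n : ℝ) ^ (1 : ℝ)) univB (fun n => (n : ℝ) ^ (2 : ℝ)) := by
  intro ε hε
  refine ⟨1 / 2, by norm_num, orbitM, 1, 1, orbitM_isDeterministic, fun O hO x => ?_⟩
  simp only [show univA.width x = inputWidth (diagEncode x) from rfl]
  -- the run
  have hw : inputWidth (diagEncode x) ≤ 1 * inputWidth (diagEncode x) := by omega
  have hrun := orbitM_run x hO hw (rounds x) le_rfl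
  have hb1 : 1 + bitOf (orb x (rounds x)) < 2 ^ (1 * inputWidth (diagEncode x)) := by
    have hb := bitOf_le_one (orb x (rounds x))
    have : 4 ≤ 2 ^ (1 * inputWidth (diagEncode x)) := by
      have h3 : 2 ≤ inputWidth (diagEncode x) := by
        unfold inputWidth
        refine le_trans (show 2 ≤ Nat.size 3 by decide) (Nat.size_le_size (le_trans ?_ (le_max_left _ _)))
        simp
      have := Nat.pow_le_pow_right (show 0 < 2 by norm_num) h3
      simpa using this
    omega
  have hOq : O (orb x (rounds x)) = [1 + bitOf (orb x (rounds x))] := by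
    have := hO (orb x (rounds x)); simp only [Set.mem_singleton_iff] at this
    rw [this, uAnswer_orb_rounds]
  have hfin := orbitM_final hOq hb1 (by omega) 0 ((List.range (rounds x)).map (orb x))
  have htot : run orbitM (1 * inputWidth (diagEncode x)) O zeroCoins (2 * rounds x + 3)
      (init (1 * inputWidth (diagEncode x)) (diagEncode x)) =
      some ⟨none, finMem (orb x (rounds x)) (1 + bitOf (orb x (rounds x))), 0, (List.range (rounds x + 1)).map (orb x)⟩ := by
    rw [run_add, hrun, Option.bind_some, hfin]
    simp [List.range_succ]
  -- the budget
  have hbudget : (1 : ℝ) * (((cost x ^ 2 : ℕ) : ℝ) ^ (1 : ℝ)) ^ (1 - 1 / 2 : ℝ) + 1 = cost x + 1 := by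
    rw [budget_eq, one_mul]
  have hfloor : ⌊(1 : ℝ) * (((cost x ^ 2 : ℕ) : ℝ) ^ (1 : ℝ)) ^ (1 - 1 / 2 : ℝ) + 1⌋₊ = cost x + 1 := by
    rw [hbudget]; exact_mod_cast Nat.floor_natCast (cost x + 1)
  refine ⟨_, (List.range (rounds x + 1)).map (orb x), haltsWithin_of_run htot (step_of_pc_eq_none rfl)
    (by rw [hfloor]; unfold cost; omega), ?_, ?_, ?_, ?_⟩
  · -- the answer
    show readOut (finMem (orb x (rounds x)) (1 + bitOf (orb x (rounds x)))) ∈ diagGood x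
    rw [readOut_finMem, bitOf_orb_rounds]
    unfold diagGood
    split_ifs <;> simp
  · -- the queries are `univB`-instances (every word list is)
    show (List.range (rounds x + 1)).map (orb x) = ((List.range (rounds x + 1)).map (orb x)).map fun q => q
    exact (List.map_id' _).symm
  · -- the ledger
    rw [hbudget, List.map_map]
    have hterm : ∀ i ∈ List.range (rounds x + 1),
        ((fun y => ((massOf y : ℝ) ^ (2 : ℝ)) ^ (1 - ε)) ∘ orb x) i ≤
          ((fun i => (((orb x i).length + massOf (orb x i) ^ 2 : ℕ) : ℝ))) i := by
      intro i hi
      show ((massOf (orb x i) : ℝ) ^ (2 : ℝ)) ^ (1 - ε) ≤ (((orb x i).length + massOf (orb x i) ^ 2 : ℕ) : ℝ)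
      have hm1 : 1 ≤ massOf (orb x i) := by
        have := (wf_orb x i).2; unfold lhOf at this
        exact le_trans (by omega) (le_max_left _ _)
      have hm1' : (1 : ℝ) ≤ (massOf (orb x i) : ℝ) ^ (2 : ℝ) := by
        rw [Real.rpow_two]; exact one_le_pow₀ (by exact_mod_cast hm1)
      calc ((massOf (orb x i) : ℝ) ^ (2 : ℝ)) ^ (1 - ε) ≤ ((massOf (orb x i) : ℝ) ^ (2 : ℝ)) ^ (1 : ℝ) :=
            Real.rpow_le_rpow_of_exponent_le hm1' (by linarith)
        _ = (massOf (orb x i) ^ 2 : ℕ) := by rw [Real.rpow_one, Real.rpow_two]; push_cast; ring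
        _ ≤ _ := by exact_mod_cast Nat.le_add_left _ _
    refine le_trans (List.sum_le_sum hterm) ?_
    have hn : ((List.range (rounds x + 1)).map fun i => (orb x i).length + massOf (orb x i) ^ 2).sum ≤ cost x := by
      unfold cost; omega
    have hc : ((List.range (rounds x + 1)).map fun i => (((orb x i).length + massOf (orb x i) ^ 2 : ℕ) : ℝ)).sum =
        ((((List.range (rounds x + 1)).map fun i => (orb x i).length + massOf (orb x i) ^ 2).sum : ℕ) : ℝ) := by
      rw [Nat.cast_list_sum, List.map_map]; rfl
    rw [hc]
    have := Nat.cast_le (α := ℝ) |>.2 hn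
    linarith
  · -- the query lengths
    rw [hbudget]
    have h1 : ((List.range (rounds x + 1)).map fun i => (orb x i).length).sum ≤
        ((List.range (rounds x + 1)).map fun i => (orb x i).length + massOf (orb x i) ^ 2).sum :=
      List.sum_le_sum fun i _ => Nat.le_add_right _ _
    have h2 : ((List.range (rounds x + 1)).map fun i => (orb x i).length + massOf (orb x i) ^ 2).sum ≤ cost x := by
      unfold cost; omega
    have h3 : (((List.range (rounds x + 1)).map (orb x)).map fun y : List ℕ => y.length).sum =
        ((List.range (rounds x + 1)).map fun i => (orb x i).length).sum := by
      simp only [List.map_map]; rfl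
    rw [show (((List.range (rounds x + 1)).map (orb x)).map fun y => (univB.encode y).length) =
      (((List.range (rounds x + 1)).map (orb x)).map fun y : List ℕ => y.length) from rfl, h3]
    have := Nat.cast_le (α := ℝ) |>.2 (le_trans h1 h2)
    linarith

end TrulySubTimeRefutation

/-! ## The refutation -/

/-- **The uncorrected transfer property, primed form, is false** in the word-RAM model. The
negated proposition is, verbatim, the transcription of VVW ICM 2018, the remark following Def. 2.1
("if `A ≤_{a,b} B` and `B` is solvable in `O(b(n)^{1-ε})` time then `A` is solvable in
`O(a(n)^{1-δ})` time"), with the budgets `a = n^α`, `b = n^β` given as propositional equalities and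
the well-formedness hypotheses `IsStandard`, but **without** any hypothesis tying the size measure
`n = A.size x` to the input length (until 2026-08-14 the named fact `FGReducible.trulySubTime'` of
`Literature.Computability.Cryptography.FGComplexity`, retired; inlined here). Counterexample: with
`univA`, `univB` of `TrulySubTimeRefutation`, `(univA, n¹) ≤_FG (univB, n²)`, `univB` is truly
sub-`n²`, both are well formed, yet `univA` is not truly sub-`n¹` (no algorithm solves it at all).
In print the statement is about running times in the input *length* on a word RAM with
`Θ(log n)`-bit words, which the decoupled `FGProblem.size` does not enforce; see
`FGReducible.trulySubTime_of_sizeFitsWord` / `FGReducible.trulySubTime'_of_sizeFitsWord` for the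
corrected, proved statement. [cite: VassilevskaWilliamsICM2018, Def. 2.1 and the remark following it] -/
theorem FGReducible.trulySubTime'_false :
    ¬ (∀ {A B : FGProblem} {a b : ℕ → ℝ} {α β : ℝ}, FGReducible A a B b → B.TrulySubTime β →
        A.IsStandard a → B.IsStandard b → (b = fun n : ℕ => (n : ℝ) ^ β) →
        (a = fun n : ℕ => (n : ℝ) ^ α) → A.TrulySubTime α) := fun h =>
  TrulySubTimeRefutation.not_trulySubTime_univA 1
    (h TrulySubTimeRefutation.fgReducible_univA_univB TrulySubTimeRefutation.univB_trulySubTime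
      TrulySubTimeRefutation.univA_isStandard TrulySubTimeRefutation.univB_isStandard rfl rfl)

/-- **The uncorrected transfer property is false** in the word-RAM model (same counterexample).
The negated proposition is, verbatim, the transcription of VVW ICM 2018, the remark following
Def. 2.1, for the budgets `n^α`, `n^β` and well-formed problems, **without** the hypothesis
`A.SizeFitsWord` (until 2026-08-14 the named fact `FGReducible.trulySubTime` of
`Literature.Computability.Cryptography.FGComplexity`, retired; inlined here). Corrected, proved
statement: `FGReducible.trulySubTime_of_sizeFitsWord` (`…_holds` in
`Literature.Computability.Cryptography.FGComplexityProofs`). [cite: VassilevskaWilliamsICM2018, Def. 2.1 and the remark following it] -/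
theorem FGReducible.trulySubTime_false :
    ¬ (∀ {A B : FGProblem} {α β : ℝ},
        FGReducible A (fun n => (n : ℝ) ^ α) B (fun n => (n : ℝ) ^ β) → B.TrulySubTime β →
        (A.IsStandard fun n => (n : ℝ) ^ α) → (B.IsStandard fun n => (n : ℝ) ^ β) →
        A.TrulySubTime α) := fun h =>
  FGReducible.trulySubTime'_false fun hr hB hA hB' hb ha => by subst hb ha; exact h hr hB hA hB'

/-! ## Equivalence versions: the uncorrected subcubic / subquadratic transfer statements are false

The uncorrected equivalence versions (VW–W J. ACM 2018, §3, Prop. 2 with Def. 3.1, resp. VVW ICM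
2018, the remark after Def. 2.1, both ways; until 2026-08-14 the named facts
`SubcubicEquivalent.trulySubTime_iff` and `SubquadraticEquivalent.trulySubTime_iff` of
`Literature.Computability.Cryptography.FGComplexity`, retired and inlined in the two theorems
closing this file) ask for a transfer in both directions of an
*equivalence* with the same budget `n ^ p` on both sides. The counterexample above is one-sided
(`(univA, n¹) ≤_FG (univB, n²)`); here it is re-run with a common exponent `p ≥ 2`: the diagonal
problem gets the size measure `costPow p`, and the converse reduction is free because `univB` has
an oracle-free linear-time algorithm. -/

/-- **A truly sub-`n^α` problem is fine-grained reducible to every problem** (`α > 0`): run its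
oracle-free algorithm and make no queries; with `ε₀` the saving of the algorithm, `δ := ε₀ / α`
gives `(n^α)^{1-δ} = n^{α-ε₀}`, and the empty query list has ledger `0`. [folklore] -/
theorem FGProblem.TrulySubTime.fgReducible_of_pos {A : FGProblem} {α : ℝ} (h : A.TrulySubTime α)
    (hα : 0 < α) (B : FGProblem) (b : ℕ → ℝ) :
    FGReducible A (fun n => (n : ℝ) ^ α) B b := by
  obtain ⟨ε₀, hε₀, C₀, M, k, hd, ho, hM⟩ := h
  intro ε _hε
  refine ⟨ε₀ / α, div_pos hε₀ hα, M, k, max C₀ 1, hd, fun O _hO x => ?_⟩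
  obtain ⟨out, hout, hrun⟩ := hM x
  rw [outputsWithin_iff_exists_haltsWithin] at hrun
  obtain ⟨c, hc, hcout⟩ := hrun
  rw [haltsWithin_iff_of_isOracleFree ho _ noOracle O] at hc
  have hq : c.queries = [] := by
    obtain ⟨n, -, hn, -⟩ := hc.exists_run
    rw [(run_coinPos_queries hd ho n hn).2, init_queries]
  have hexp : ((A.size x : ℝ) ^ α) ^ (1 - ε₀ / α) = (A.size x : ℝ) ^ (α - ε₀) := by
    rw [← Real.rpow_mul (Nat.cast_nonneg _)]
    congr 1
    field_simp
  have h0 : 0 ≤ ((A.size x : ℝ) ^ α) ^ (1 - ε₀ / α) := by positivity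
  have hC : (0 : ℝ) ≤ max C₀ 1 := le_trans zero_le_one (le_max_right _ _)
  have hbudget : 0 ≤ max C₀ 1 * ((A.size x : ℝ) ^ α) ^ (1 - ε₀ / α) + max C₀ 1 := by positivity
  refine ⟨c, [], hc.mono ?_, hcout ▸ hout, by rw [hq]; rfl, by simpa using hbudget,
    by simpa using hbudget⟩
  refine Nat.floor_le_floor ?_
  rw [hexp] at h0 ⊢
  nlinarith [le_max_left C₀ 1, mul_le_mul_of_nonneg_right (le_max_left C₀ 1) h0]

namespace TrulySubTimeRefutation

/-! ### One ledger exponent `p ≥ 2` on both sides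

Both budgets are `n ^ p` (`p = 3`, `2`), so the cost charged to the diagonal problem must dominate
the `p`-th powers of the query masses; everything else is as for `univA`. -/

/-- `((c : ℝ) ^ p) ^ (1 - (1 - 1/p)) = c`: the budget `n ^ p` at `δ := 1 - 1/p`. [folklore] -/
theorem rpow_natCast_rpow_budget (c p : ℕ) (hp : p ≠ 0) :
    (((c : ℝ)) ^ (p : ℝ)) ^ (1 - (1 - (p : ℝ)⁻¹)) = c := by
  rw [sub_sub_cancel, Real.rpow_rpow_inv (Nat.cast_nonneg c) (Nat.cast_ne_zero.2 hp)]

/-- `(m : ℝ) ^ (p : ℝ)` is the natural number `m ^ p`. [folklore] -/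
theorem rpow_natCast_eq_cast_pow (m p : ℕ) : ((m : ℝ)) ^ (p : ℝ) = ((m ^ p : ℕ) : ℝ) := by
  rw [Real.rpow_natCast, Nat.cast_pow]

/-- **The oracle problem is well formed for every budget `n ^ p`, `p ≥ 2`.** [folklore] -/
theorem univB_isStandard_pow {p : ℕ} (hp : 2 ≤ p) : univB.IsStandard fun n => (n : ℝ) ^ (p : ℝ) where
  nonneg := fun n => Real.rpow_nonneg (Nat.cast_nonneg _) _
  length_le := ⟨1, 1 - (p : ℝ)⁻¹, by
      have : (p : ℝ)⁻¹ < 1 := inv_lt_one_of_one_lt₀ (by exact_mod_cast hp)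
      linarith, fun q => by
    show ((q.length : ℕ) : ℝ) ≤ 1 * (((massOf q : ℕ) : ℝ) ^ (p : ℝ)) ^ (1 - (1 - (p : ℝ)⁻¹)) + 1
    rw [rpow_natCast_rpow_budget _ _ (by omega), one_mul]
    have : q.length ≤ massOf q := le_max_left _ _
    have : (q.length : ℝ) ≤ massOf q := by exact_mod_cast this
    linarith⟩
  width_le := ⟨1, fun q => by
    show ((inputWidth q : ℕ) : ℝ) ≤ 1 * (((massOf q : ℕ) : ℝ) ^ (p : ℝ)) + 1
    rw [rpow_natCast_eq_cast_pow, one_mul]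
    have h1 := inputWidth_le_massOf q
    have h2 : massOf q ≤ massOf q ^ p := Nat.le_self_pow (by omega) _
    exact_mod_cast (show inputWidth q ≤ massOf q ^ p + 1 by omega)⟩
  hasWordOutputs := univB_hasWordOutputs

/-- **The oracle problem is truly sub-`n ^ p`** for every `p ≥ 2` (it is solvable in linear time). [folklore] -/
theorem univB_trulySubTime_pow {p : ℕ} (hp : 2 ≤ p) : univB.TrulySubTime p :=
  univB_trulySubTime.mono (by exact_mod_cast hp)

/-- The cost of the reduction on `x` for the ledger exponent `p`: its running time plus, for every
query, its length and the `p`-th power of its mass (so `cost = costPow 2`). [folklore] -/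
noncomputable def costPow (p : ℕ) (x : DiagInst) : ℕ :=
  2 * rounds x + 3 +
    ((List.range (rounds x + 1)).map fun i => (orb x i).length + massOf (orb x i) ^ p).sum

/-- **The diagonal problem with size measure `costPow p`** (same instances, encoding and answers
as `univA`). [folklore] -/
@[reducible] noncomputable def univAPow (p : ℕ) : FGProblem where
  Inst := DiagInst
  encode := diagEncode
  size := costPow p
  Good := diagGood

/-- The sum of the per-query charges is within the cost. [folklore] -/
theorem sum_le_costPow (p : ℕ) (x : DiagInst) :
    ((List.range (rounds x + 1)).map fun i => (orb x i).length + massOf (orb x i) ^ p).sum ≤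
      costPow p x := by
  unfold costPow; omega

/-- The running time of the reduction is within the cost. [folklore] -/
theorem steps_le_costPow (p : ℕ) (x : DiagInst) : 2 * rounds x + 3 ≤ costPow p x := by
  unfold costPow; omega

/-- Each query's length and `p`-th power of mass is within the cost. [folklore] -/
theorem term_le_costPow (p : ℕ) (x : DiagInst) {i : ℕ} (hi : i ≤ rounds x) :
    (orb x i).length + massOf (orb x i) ^ p ≤ costPow p x := by
  refine le_trans ?_ (sum_le_costPow p x)
  exact List.single_le_sum (fun _ _ => Nat.zero_le _) _
    (List.mem_map.2 ⟨i, List.mem_range.2 (by omega), rfl⟩)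

/-- The encoding length and the `p`-th power of its mass are within the cost. [folklore] -/
theorem length_add_massOf_pow_le_costPow (p : ℕ) (x : DiagInst) :
    (diagEncode x).length + massOf (diagEncode x) ^ p ≤ costPow p x := by
  have := term_le_costPow p x (Nat.zero_le _)
  simpa only [orb] using this

/-- **No word-RAM algorithm solves the diagonal problem** (whatever its size measure), in any
time bound: run the candidate on its own code. [folklore] -/
theorem not_inTimeInst_univAPow (p : ℕ) (T : (univAPow p).Inst → ℕ) : ¬ (univAPow p).InTimeInst T := by
  rintro ⟨M, k, hd, ho, hM⟩
  let x₀ : DiagInst := ⟨M, k, hd, ho⟩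
  obtain ⟨out, hout, hrun⟩ := hM x₀
  change out ∈ diagGood x₀ at hout
  change OutputsWithin M (k * inputWidth (diagEncode x₀)) noOracle zeroCoins (diagEncode x₀) out (T x₀) at hrun
  unfold diagGood at hout
  by_cases h : SelfAccepts x₀
  · rw [if_pos h, Set.mem_singleton_iff] at hout
    subst hout
    obtain ⟨t, ht⟩ := h
    have := outputsWithin_unique_holds hrun ht
    simp at this
  · rw [if_neg h, Set.mem_singleton_iff] at hout
    subst hout
    exact h ⟨_, hrun⟩

/-- The diagonal problem `univAPow p` is not truly sub-`n^α`, for any `α`. [folklore] -/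
theorem not_trulySubTime_univAPow (p : ℕ) (α : ℝ) : ¬ (univAPow p).TrulySubTime α := by
  rintro ⟨ε, -, C, h⟩
  exact not_inTimeInst_univAPow p _ h

/-- The answers of `univAPow p` are `[1]` or `[2]`. [folklore] -/
theorem univAPow_hasWordOutputs (p : ℕ) : (univAPow p).HasWordOutputs := by
  refine ⟨2, 1, fun x out hout => ?_⟩
  change out ∈ diagGood x at hout
  have hw : 4 ≤ 2 ^ (2 * (univAPow p).width x) := by
    have := Nat.pow_le_pow_right (show 0 < 2 by norm_num) (show 2 ≤ 2 * (univAPow p).width x by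
      have := (univAPow p).width_pos x; omega)
    simpa using this
  unfold diagGood at hout
  split_ifs at hout <;>
  · rw [Set.mem_singleton_iff] at hout; subst hout
    exact ⟨by simp, fun v hv => by simp at hv; omega⟩

/-- **The diagonal problem `univAPow p` is well formed for the budget `n ^ p`** (`p ≥ 2`; `δ = 1 - 1/p`). [folklore] -/
theorem univAPow_isStandard {p : ℕ} (hp : 2 ≤ p) : (univAPow p).IsStandard fun n => (n : ℝ) ^ (p : ℝ) where
  nonneg := fun n => Real.rpow_nonneg (Nat.cast_nonneg _) _
  length_le := ⟨1, 1 - (p : ℝ)⁻¹, by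
      have : (p : ℝ)⁻¹ < 1 := inv_lt_one_of_one_lt₀ (by exact_mod_cast hp)
      linarith, fun x => by
    show ((diagEncode x).length : ℝ) ≤
      1 * (((costPow p x : ℕ) : ℝ) ^ (p : ℝ)) ^ (1 - (1 - (p : ℝ)⁻¹)) + 1
    rw [rpow_natCast_rpow_budget _ _ (by omega), one_mul]
    have := length_add_massOf_pow_le_costPow p x
    have : ((diagEncode x).length : ℝ) ≤ costPow p x := by exact_mod_cast (by omega : (diagEncode x).length ≤ costPow p x)
    linarith⟩
  width_le := ⟨1, fun x => by
    show ((inputWidth (diagEncode x) : ℕ) : ℝ) ≤ 1 * (((costPow p x : ℕ) : ℝ) ^ (p : ℝ)) + 1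
    rw [rpow_natCast_eq_cast_pow, one_mul]
    have h1 := inputWidth_le_massOf (diagEncode x)
    have h2 := length_add_massOf_pow_le_costPow p x
    have h3 : massOf (diagEncode x) ≤ massOf (diagEncode x) ^ p := Nat.le_self_pow (by omega) _
    have h4 : costPow p x ≤ costPow p x ^ p := Nat.le_self_pow (by omega) _
    exact_mod_cast (show inputWidth (diagEncode x) ≤ costPow p x ^ p + 1 by omega)⟩
  hasWordOutputs := univAPow_hasWordOutputs p

/-- **`(univAPow p, n^p) ≤_FG (univB, n^p)`** for `p ≥ 2`: the orbit reduction `orbitM`, with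
`δ := 1 - 1/p` (budget `costPow p x + 1`) and every ledger term `(mᵢ^p)^{1-ε} ≤ mᵢ^p` charged to
the cost. [folklore] -/
theorem fgReducible_univAPow_univB {p : ℕ} (hp : 2 ≤ p) :
    FGReducible (univAPow p) (fun n => (n : ℝ) ^ (p : ℝ)) univB (fun n => (n : ℝ) ^ (p : ℝ)) := by
  intro ε hε
  refine ⟨1 - (p : ℝ)⁻¹, by
      have : (p : ℝ)⁻¹ < 1 := inv_lt_one_of_one_lt₀ (by exact_mod_cast hp)
      linarith, orbitM, 1, 1, orbitM_isDeterministic, fun O hO x => ?_⟩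
  simp only [show (univAPow p).width x = inputWidth (diagEncode x) from rfl]
  -- the run
  have hw : inputWidth (diagEncode x) ≤ 1 * inputWidth (diagEncode x) := by omega
  have hrun := orbitM_run x hO hw (rounds x) le_rfl
  have hb1 : 1 + bitOf (orb x (rounds x)) < 2 ^ (1 * inputWidth (diagEncode x)) := by
    have hb := bitOf_le_one (orb x (rounds x))
    have : 4 ≤ 2 ^ (1 * inputWidth (diagEncode x)) := by
      have h3 : 2 ≤ inputWidth (diagEncode x) := by
        unfold inputWidth
        refine le_trans (show 2 ≤ Nat.size 3 by decide) (Nat.size_le_size (le_trans ?_ (le_max_left _ _)))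
        simp
      have := Nat.pow_le_pow_right (show 0 < 2 by norm_num) h3
      simpa using this
    omega
  have hOq : O (orb x (rounds x)) = [1 + bitOf (orb x (rounds x))] := by
    have := hO (orb x (rounds x)); simp only [Set.mem_singleton_iff] at this
    rw [this, uAnswer_orb_rounds]
  have hfin := orbitM_final hOq hb1 (by omega) 0 ((List.range (rounds x)).map (orb x))
  have htot : run orbitM (1 * inputWidth (diagEncode x)) O zeroCoins (2 * rounds x + 3)
      (init (1 * inputWidth (diagEncode x)) (diagEncode x)) =
      some ⟨none, finMem (orb x (rounds x)) (1 + bitOf (orb x (rounds x))), 0,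
        (List.range (rounds x + 1)).map (orb x)⟩ := by
    rw [run_add, hrun, Option.bind_some, hfin]
    simp [List.range_succ]
  -- the budget
  have hbudget : (1 : ℝ) * ((((costPow p x : ℕ) : ℝ) ^ (p : ℝ)) ^ (1 - (1 - (p : ℝ)⁻¹))) + 1 =
      costPow p x + 1 := by
    rw [rpow_natCast_rpow_budget _ _ (by omega), one_mul]
  have hfloor : ⌊(1 : ℝ) * ((((costPow p x : ℕ) : ℝ) ^ (p : ℝ)) ^ (1 - (1 - (p : ℝ)⁻¹))) + 1⌋₊ =
      costPow p x + 1 := by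
    rw [hbudget]; exact_mod_cast Nat.floor_natCast (costPow p x + 1)
  have hsteps := steps_le_costPow p x
  have hsum := sum_le_costPow p x
  refine ⟨_, (List.range (rounds x + 1)).map (orb x), haltsWithin_of_run htot (step_of_pc_eq_none rfl)
    (by rw [hfloor]; omega), ?_, ?_, ?_, ?_⟩
  · -- the answer
    show readOut (finMem (orb x (rounds x)) (1 + bitOf (orb x (rounds x)))) ∈ diagGood x
    rw [readOut_finMem, bitOf_orb_rounds]
    unfold diagGood
    split_ifs <;> simp
  · -- the queries are `univB`-instances (every word list is)
    show (List.range (rounds x + 1)).map (orb x) = ((List.range (rounds x + 1)).map (orb x)).map fun q => q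
    exact (List.map_id' _).symm
  · -- the ledger
    rw [hbudget, List.map_map]
    have hterm : ∀ i ∈ List.range (rounds x + 1),
        ((fun y => (((massOf y : ℕ) : ℝ) ^ (p : ℝ)) ^ (1 - ε)) ∘ orb x) i ≤
          (fun i => (((orb x i).length + massOf (orb x i) ^ p : ℕ) : ℝ)) i := by
      intro i _
      show (((massOf (orb x i) : ℕ) : ℝ) ^ (p : ℝ)) ^ (1 - ε) ≤
        (((orb x i).length + massOf (orb x i) ^ p : ℕ) : ℝ)
      have hm1 : 1 ≤ massOf (orb x i) := by
        have := (wf_orb x i).2; unfold lhOf at this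
        exact le_trans (by omega) (le_max_left _ _)
      have hm1' : (1 : ℝ) ≤ ((massOf (orb x i) : ℕ) : ℝ) ^ (p : ℝ) := by
        rw [rpow_natCast_eq_cast_pow]; exact_mod_cast Nat.one_le_pow _ _ hm1
      calc (((massOf (orb x i) : ℕ) : ℝ) ^ (p : ℝ)) ^ (1 - ε)
          ≤ (((massOf (orb x i) : ℕ) : ℝ) ^ (p : ℝ)) ^ (1 : ℝ) :=
            Real.rpow_le_rpow_of_exponent_le hm1' (by linarith)
        _ = ((massOf (orb x i) ^ p : ℕ) : ℝ) := by rw [Real.rpow_one, rpow_natCast_eq_cast_pow]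
        _ ≤ _ := by exact_mod_cast Nat.le_add_left _ _
    refine le_trans (List.sum_le_sum hterm) ?_
    have hc : ((List.range (rounds x + 1)).map fun i =>
        (((orb x i).length + massOf (orb x i) ^ p : ℕ) : ℝ)).sum =
        ((((List.range (rounds x + 1)).map fun i =>
          (orb x i).length + massOf (orb x i) ^ p).sum : ℕ) : ℝ) := by
      rw [Nat.cast_list_sum, List.map_map]; rfl
    rw [hc]
    have := Nat.cast_le (α := ℝ) |>.2 hsum
    linarith
  · -- the query lengths
    rw [hbudget]
    have h1 : ((List.range (rounds x + 1)).map fun i => (orb x i).length).sum ≤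
        ((List.range (rounds x + 1)).map fun i => (orb x i).length + massOf (orb x i) ^ p).sum :=
      List.sum_le_sum fun i _ => Nat.le_add_right _ _
    have h3 : (((List.range (rounds x + 1)).map (orb x)).map fun y : List ℕ => y.length).sum =
        ((List.range (rounds x + 1)).map fun i => (orb x i).length).sum := by
      simp only [List.map_map]; rfl
    rw [show (((List.range (rounds x + 1)).map (orb x)).map fun y => (univB.encode y).length) =
      (((List.range (rounds x + 1)).map (orb x)).map fun y : List ℕ => y.length) from rfl, h3]
    have := Nat.cast_le (α := ℝ) |>.2 (le_trans h1 hsum)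
    linarith

/-- **`(univB, n^p) ≤_FG (univAPow p, n^p)`** trivially: `univB` is solved in linear time without
queries. [folklore] -/
theorem fgReducible_univB_univAPow {p : ℕ} (hp : 2 ≤ p) :
    FGReducible univB (fun n => (n : ℝ) ^ (p : ℝ)) (univAPow p) (fun n => (n : ℝ) ^ (p : ℝ)) :=
  (univB_trulySubTime_pow hp).fgReducible_of_pos (by positivity) _ _

/-- **`univAPow p ≡_p univB`**: the two problems are fine-grained equivalent for the budget `n ^ p`. [folklore] -/
theorem fgEquivalent_univAPow_univB {p : ℕ} (hp : 2 ≤ p) :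
    FGEquivalent (univAPow p) (fun n => (n : ℝ) ^ (p : ℝ)) univB (fun n => (n : ℝ) ^ (p : ℝ)) :=
  ⟨fgReducible_univAPow_univB hp, fgReducible_univB_univAPow hp⟩

end TrulySubTimeRefutation

/-! ## The refutation of the equivalence versions -/

open TrulySubTimeRefutation in
/-- **The counterexample, packaged**: for every `p ≥ 2` there are problems `A ≡_p B`, both well
formed for the budget `n ^ p`, with `B` truly sub-`n ^ p` and `A` not truly sub-`n ^ α` for any
`α` (no word-RAM algorithm solves `A`). [folklore] -/
theorem exists_fgEquivalent_pow_not_trulySubTime {p : ℕ} (hp : 2 ≤ p) :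
    ∃ A B : FGProblem, FGEquivalent A (fun n => (n : ℝ) ^ (p : ℝ)) B (fun n => (n : ℝ) ^ (p : ℝ)) ∧
      (A.IsStandard fun n => (n : ℝ) ^ (p : ℝ)) ∧ (B.IsStandard fun n => (n : ℝ) ^ (p : ℝ)) ∧
      B.TrulySubTime p ∧ ∀ α : ℝ, ¬ A.TrulySubTime α :=
  ⟨univAPow p, univB, fgEquivalent_univAPow_univB hp, univAPow_isStandard hp, univB_isStandard_pow hp,
    univB_trulySubTime_pow hp, not_trulySubTime_univAPow p⟩

/-- The counterexample at `p = 3`: subcubically equivalent well-formed problems, one truly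
subcubic, the other with no algorithm at all. [folklore] -/
theorem exists_subcubicEquivalent_not_trulySubTime :
    ∃ A B : FGProblem, SubcubicEquivalent A B ∧
      (A.IsStandard fun n => (n : ℝ) ^ (3 : ℝ)) ∧ (B.IsStandard fun n => (n : ℝ) ^ (3 : ℝ)) ∧
      B.TrulySubTime 3 ∧ ∀ α : ℝ, ¬ A.TrulySubTime α := by
  have h := exists_fgEquivalent_pow_not_trulySubTime (p := 3) (by norm_num)
  simp only [Nat.cast_ofNat] at h
  exact h

/-- The counterexample at `p = 2`: subquadratically equivalent well-formed problems, one truly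
subquadratic, the other with no algorithm at all. [folklore] -/
theorem exists_subquadraticEquivalent_not_trulySubTime :
    ∃ A B : FGProblem, SubquadraticEquivalent A B ∧
      (A.IsStandard fun n => (n : ℝ) ^ (2 : ℝ)) ∧ (B.IsStandard fun n => (n : ℝ) ^ (2 : ℝ)) ∧
      B.TrulySubTime 2 ∧ ∀ α : ℝ, ¬ A.TrulySubTime α := by
  have h := exists_fgEquivalent_pow_not_trulySubTime (p := 2) (by norm_num)
  simp only [Nat.cast_ofNat] at h
  exact h

/-- **The uncorrected subcubic-equivalence transfer is false** in the word-RAM model. The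
negated proposition is, verbatim, the transcription of VW–W J. ACM 2018, §3, Prop. 2 with Def. 3.1
("If `A ≤₃ B`, then a truly subcubic algorithm for `B` implies a truly subcubic algorithm for `A`",
both directions of `A ≡₃ B`) for well-formed problems but *without tying the size measure to the
input length* (until 2026-08-14 the named fact `SubcubicEquivalent.trulySubTime_iff` of
`Literature.Computability.Cryptography.FGComplexity`, retired; inlined here). Counterexample:
`univAPow 3 ≡₃ univB`, both well formed for `n ^ 3`, `univB` truly subcubic, yet `univAPow 3` has
no algorithm. The printed Prop. 2 is about "computational problems on `n × n` matrices"
(loc. cit., p. 27:11: size `n ≤` input length, `Θ(log n)`-bit words); the corrected, proved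
statement is `SubcubicEquivalent.trulySubTime_iff_of_sizeFitsWord`
(`…_holds` in `Literature.Computability.Cryptography.FGComplexityProofs`).
[cite: VassilevskaWilliamsWilliams2018, §3, Def. 3.1 and Prop. 2] -/
theorem SubcubicEquivalent.trulySubTime_iff_false :
    ¬ (∀ {A B : FGProblem}, SubcubicEquivalent A B →
        (A.IsStandard fun n => (n : ℝ) ^ (3 : ℝ)) → (B.IsStandard fun n => (n : ℝ) ^ (3 : ℝ)) →
        (A.TrulySubTime 3 ↔ B.TrulySubTime 3)) := fun h => by
  obtain ⟨A, B, hAB, hA, hB, hBt, hAt⟩ := exists_subcubicEquivalent_not_trulySubTime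
  exact hAt 3 ((h hAB hA hB).2 hBt)

/-- **The uncorrected subquadratic-equivalence transfer is false** in the word-RAM model
(VVW ICM 2018, §2.2, the remark after Def. 2.1, applied both ways with `a = b = n²`, for
well-formed problems but without tying the size measure to the input length; until 2026-08-14 the
named fact `SubquadraticEquivalent.trulySubTime_iff` of
`Literature.Computability.Cryptography.FGComplexity`, retired; inlined here): same counterexample
at `p = 2`. Corrected, proved statement: `SubquadraticEquivalent.trulySubTime_iff_of_sizeFitsWord`
(`…_holds` in `Literature.Computability.Cryptography.FGComplexityProofs`).
[cite: VassilevskaWilliamsICM2018, §2.2, Def. 2.1 and the remark following it] -/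
theorem SubquadraticEquivalent.trulySubTime_iff_false :
    ¬ (∀ {A B : FGProblem}, SubquadraticEquivalent A B →
        (A.IsStandard fun n => (n : ℝ) ^ (2 : ℝ)) → (B.IsStandard fun n => (n : ℝ) ^ (2 : ℝ)) →
        (A.TrulySubTime 2 ↔ B.TrulySubTime 2)) := fun h => by
  obtain ⟨A, B, hAB, hA, hB, hBt, hAt⟩ := exists_subquadraticEquivalent_not_trulySubTime
  exact hAt 2 ((h hAB hA hB).2 hBt)

end Literature.Computability.Cryptography
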